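import Literature.Computability.AlgebraicComplexity.KV20UniversalMapWriter
import Literature.Barriers.ValiantsHypothesis.BILPS19HMinRank1ToHQuadProofs
import Literature.Computability.AlgebraicComplexity.ConstantFreeNumerals
import Literature.Computability.Complexity.ReductionsProofs
import Literature.Computability.Complexity.StringCopy
import Literature.Computability.Complexity.CodeFPLists
import HarnessLib

/-!
# Kumar–Volk 2020/2022, Cor 1.3 (reduction roster, brick (R)): the certificate relation of the
# `FP^{NP}` construction is in `P` under `PIT ∈ P` — with its soundness and completeness

Source: M. Kumar, B. L. Volk, ACM TOCT 14(2) (2022) art. 6 = arXiv:2003.12938, §6 = arXiv §5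
(proof of Cor 1.3, p0009:L8–13): "Let `L ⊆ {(1^n, x)}` … there exists a string `y` … such that `xy`
describes a … circuit `C` … `C ≢ 0` but `C ∘ U ≡ 0`. By [the hypothesis `PIT ∈ P`] we have that
`L ∈ NP`. … we can find a matrix `M` such that `C(M) ≠ 0`. By the properties of … the map `U`, `M`
does not have linear circuits of size less than `n²/200`." Cell val-lit, roster RULING (105)/(106)
and the OWNER's DESIGN v3 (x5 g6, np bus 2026-08-27 12:48Z/12:53Z): the NON-ROOT POINT is part of
the `NP` witness — the relation certified is

  `R = { ⟨1ⁿ, ⟨y, z⟩⟩ : (C_y ∘ Ũ_n ≡ 0) ∧ (C_y(a_z) ≠ 0) }`,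

`C_y` the guessed gate list read off `y` (the tree's total reader `KIReduction.readBlock`), `a_z`
the integer point read off `z` (the total integer-list decoder `BILPS19Thm34.decIntList`, padded
with `0`), `Ũ_n` the INTEGER universal map for size `s = n²/200` (`KumarVolk2020.universalMapInt`,
brick (Uℤ)). Both conjuncts are polynomial identity tests of integer circuits written in polynomial
time (brick (W): `KV20UniversalMapWriter.lean`; the evaluation circuit is x5 g5's
`BILPS2019Cor42.evalCircuit` verbatim), so `R ∈ P` as soon as `PITLanguage ∈ P`. PRINT DEVIATION
(disclosed per RULING (105)(c)(i)): the print certifies "`C` is almost-MD" syntactically (Def 13 /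
Lemma 14, Malod–Portier) and then FINDS the non-root deterministically by Lemma 15 (arXiv
p0008:L13–34); here the non-root is guessed together with `C` and certified by one more identity
test (arXiv p0009:L8–13 uses `PIT ∈ P` inside the verifier in the same way for "`C ≢ 0`"), so
neither Lemma 14 nor Lemma 15 is formalised; the existence of a small non-root (degree `≤ n³` ⇒ a
grid point in `{0, …, n³}^{n²}`) is the assembly's business (x5, `KV20Cor13Assembly.lean`).

* §1 total readers of the input `⟨1ⁿ, ⟨y, z⟩⟩`: `nOf`, `yOf`, `zOf`, the size `corS n = n²/200`,
  the point `ptFun z` / `ptPad z N` (first `N` entries of `decIntList z`, zero-padded);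
* §2 the three string functions `compWord` (code of `C_y ∘ Ũ_n`, `KumarVolk2020.UnivCircuit.univCircuit`),
  `evalWord` (code of `BILPS2019Cor42.evalCircuit (n·n) (ptFun z) C_y`), `ptList` (the honest code of
  the padded point, the OUTPUT of the `FP^{NP}` function of Cor 1.3 (2)) — all in `FP`
  (`compWord_mem_FP`, `evalWord_mem_FP`, `ptList_mem_FP`);
* §3 `certRel := {u | compWord u ∈ PITLanguage ∧ evalWord u ∉ PITLanguage}` and
  **`certRel_mem_P : PITLanguage ∈ P → certRel ∈ P`**;
* §4 `mem_certRel_iff` (the two identity tests, semantically), **`certRel_sound`** and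
  **`certRel_complete`** in the shapes of the assembly's contract (`hsound`, `hcomplete`), the
  universal map entering as `q ↦ universalMapInt n (corS n) (finProdFinEquiv.symm q)`.

Theorem-only file with plumbing `def`s; 0 facts. HONEST FRAMING (val-lit): Boolean plumbing of a
published CONDITIONAL result (`PIT ∈ P ⇒` one of two lower bounds); census `+0` by design;
`VP ≠ VNP` is NOT proved and nothing here bears on it.

## References

* [KumarVolk2022] M. Kumar, B. L. Volk, ACM TOCT 14(2) (2022) art. 6, doi:10.1145/3543685 =
  arXiv:2003.12938 — §6 / arXiv §5 p0009:L8–13 (the `NP` language and the search), p0008:L13–34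
  (Def 13, Lemmas 14–15, replaced here as disclosed above).
* [KabanetsImpagliazzo2003] V. Kabanets, R. Impagliazzo, STOC 2003, proof of Cor. 12 (p. 358)
  (guessed gate lists, identity tests of written circuits).
* [AroraBarak2009] S. Arora, B. Barak, *Computational Complexity*, CUP 2009, §1.3 (closure of
  `P`), Thm. 2.8 (composition), §0.1 (codes).
-/

noncomputable section

namespace Literature.Computability.AlgebraicComplexity

namespace KumarVolk2020

namespace Cor13Cert

open MvPolynomial Literature.Computability.Complexity ArithCircuit KIReduction UnivCircuit
open Literature.Barriers.ValiantsHypothesis.BILPS2019Cor42 Literature.Barriers.ValiantsHypothesis.BILPS19Thm34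
open _root_.Computability CodeFP Brick CanonCode

/-! ### §1. Total readers of the input `⟨1ⁿ, ⟨y, z⟩⟩` -/

section Readers

/-- `n`, read as the LENGTH of the first component (total; `= n` on `⟨1ⁿ, w⟩`). [cite: KumarVolk2022, §6 (proof of Cor. 1.3: "L ⊆ {(1^n, x)}")] -/
def nOf (u : List Bool) : ℕ := (fstF u).length

/-- The guessed-circuit component `y` of `⟨1ⁿ, ⟨y, z⟩⟩` (total). [cite: KumarVolk2022, §6 (proof of Cor. 1.3)] -/
def yOf (u : List Bool) : List Bool := fstF (sndF u)

/-- The point component `z` of `⟨1ⁿ, ⟨y, z⟩⟩` (total). [cite: KumarVolk2022, §6 (proof of Cor. 1.3)] -/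
def zOf (u : List Bool) : List Bool := sndF (sndF u)

/-- The size parameter of Cor 1.3: `s = n²/200` (rounded down). [cite: KumarVolk2022, Thm. 1.2 and §6] -/
def corS (n : ℕ) : ℕ := n ^ 2 / 200

/-- The integer point read off `z`: entry `q` of the total integer-list decoding of `z`, `0` past
the end. [cite: KumarVolk2022, §6 (proof of Cor. 1.3: "a matrix M")] -/
def ptFun (z : List Bool) (q : ℕ) : ℤ := (decIntList z).getD q 0

/-- The first `N` entries of the point read off `z` (zero-padded). [cite: KumarVolk2022, §6 (proof of Cor. 1.3)] -/
def ptPad (z : List Bool) (N : ℕ) : List ℤ := (List.range N).map (ptFun z)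

/-- `nOf ⟨1ⁿ, w⟩ = n`. [cite: AroraBarak2009, §0.1] -/
@[simp] theorem nOf_pair (n : ℕ) (w : List Bool) : nOf (boolPair (unaryEncodeNat n) w) = n := by
  rw [nOf, fstF_boolPair, show (unaryEncodeNat n : List Bool) = unE n from rfl, length_unE]

/-- `yOf ⟨x, w⟩ = fstF w`. [cite: AroraBarak2009, §0.1] -/
@[simp] theorem yOf_pair (x w : List Bool) : yOf (boolPair x w) = fstF w := by rw [yOf, sndF_boolPair]

/-- `zOf ⟨x, w⟩ = sndF w`. [cite: AroraBarak2009, §0.1] -/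
@[simp] theorem zOf_pair (x w : List Bool) : zOf (boolPair x w) = sndF w := by rw [zOf, sndF_boolPair]

/-- `|ptPad z N| = N`. [folklore] -/
@[simp] private theorem length_ptPad (z : List Bool) (N : ℕ) : (ptPad z N).length = N := by simp [ptPad]

/-- `ptPad` is the table of `ptFun` on `Fin N`. [folklore] -/
private theorem ptPad_eq_ofFn (z : List Bool) (N : ℕ) : ptPad z N = List.ofFn fun q : Fin N => ptFun z q := by
  apply List.ext_getElem
  · simp [ptPad]
  · intro i h₁ h₂
    simp [ptPad]

/-- The point of an honest code is the coded point. [cite: AroraBarak2009, §0.1] -/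
theorem ptFun_encode {N : ℕ} (a : Fin N → ℤ) (q : Fin N) :
    ptFun (encodingIntBool.listBool.encode (List.ofFn a)) q = a q := by
  -- the total decoder reads back honest codes (`CanonCode.canonListFn_eq`, `Encoding.decode_encode`)
  have hdec : decIntList (encodingIntBool.listBool.encode (List.ofFn a)) = List.ofFn a := by
    have h := (canonListFn_eq encodingIntBool decInt decode_int canonIntFn_eq
      (encodingIntBool.listBool.encode (List.ofFn a))).1
    rw [Encoding.decode_encode] at h
    exact (Option.some.inj h).symm
  rw [ptFun, hdec, List.getD_eq_getElem?_getD, List.getElem?_ofFn]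
  simp

/-- Padding by `take (l ++ replicate N 0)`. [folklore] -/
private theorem take_append_replicate (l : List ℤ) (N : ℕ) :
    (l ++ List.replicate N 0).take N = (List.range N).map fun q => l.getD q 0 := by
  apply List.ext_getElem
  · simp
  · intro i h₁ h₂
    simp only [List.length_take, List.length_append, List.length_replicate, List.length_map,
      List.length_range] at h₁ h₂
    rw [List.getElem_take, List.getElem_map, List.getElem_range, List.getD_eq_getElem?_getD]
    by_cases hi : i < l.length
    · rw [List.getElem_append_left hi, List.getElem?_eq_getElem hi]; rfl
    · rw [List.getElem_append_right (by omega), List.getElem_replicate, List.getElem?_eq_none (by omega)]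
      rfl

end Readers

/-! ### §2. The two identity-test instances and the point code, as string functions in `FP` -/

section Words

/-- **The composition word**: the code of the integer circuit `C_y ∘ Ũ_n` in `s + s` variables,
`s = corS n`. [cite: KumarVolk2022, §6 (proof of Cor. 1.3: "C ∘ U ≡ 0")] -/
def compWord (u : List Bool) : List Bool :=
  circuitWord (corS (nOf u) + corS (nOf u)) (univCircuit (nOf u) (corS (nOf u)) (readBlock (yOf u)))

/-- **The evaluation word**: the code of the closed circuit evaluating `C_y` at the point read off
`z` (x5 g5's `BILPS2019Cor42.evalCircuit`). [cite: KumarVolk2022, §6 (proof of Cor. 1.3: "C(M) ≠ 0")] -/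
def evalWord (u : List Bool) : List Bool :=
  circuitWord 0 (evalCircuit (nOf u * nOf u) (ptFun (zOf u)) (readBlock (yOf u)))

/-- **The point code**: the honest code of the padded point (an `n²`-list of integers, row-major —
the OUTPUT format of Cor 1.3 (2), cf. `intMatrixOfList`). [cite: KumarVolk2022, Cor. 1.3 (item 2)] -/
def ptList (u : List Bool) : List Bool :=
  encodingIntBool.listBool.encode (ptPad (zOf u) (nOf u * nOf u))

variable {T : Type} {eT : T → List Bool}

/-- Unary product (via the tree's `unitsMul`). [cite: AroraBarak2009, §1.3] -/
private theorem unMulFP {f g : T → ℕ} (hf : CodeFP eT unE f) (hg : CodeFP eT unE g) :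
    CodeFP eT unE (fun t => f t * g t) :=
  ((ulength unitE).comp (unitsMul.comp ((replicateUnit.comp hf).pair (replicateUnit.comp hg)))).congr
    fun p => by simp

/-- `fstF` on codes (the identity encoder). [folklore] -/
private theorem fstFP : CodeFP strE strE fstF := of_fn fstF fstF_mem_FP fun _ => rfl

/-- `sndF` on codes. [folklore] -/
private theorem sndFP : CodeFP strE strE sndF := of_fn sndF sndF_mem_FP fun _ => rfl

/-- `nOf` in unary. [cite: AroraBarak2009, §1.3] -/
private theorem nOfFP : CodeFP strE unE nOf := (strLength.comp fstFP).congr fun _ => rfl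

/-- `yOf` on codes. [cite: AroraBarak2009, §1.3] -/
private theorem yOfFP : CodeFP strE strE yOf := (fstFP.comp sndFP).congr fun _ => rfl

/-- `zOf` on codes. [cite: AroraBarak2009, §1.3] -/
private theorem zOfFP : CodeFP strE strE zOf := (sndFP.comp sndFP).congr fun _ => rfl

/-- `n · n` in unary. [cite: AroraBarak2009, §1.3] -/
private theorem nnFP : CodeFP strE unE (fun u => nOf u * nOf u) := unMulFP nOfFP nOfFP

/-- `corS n = n²/200` in unary (a binary division, capped back to unary by the budget `n²`).
[cite: AroraBarak2009, §1.3] -/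
private theorem corSFP : CodeFP strE unE (fun u => corS (nOf u)) := by
  have hb : CodeFP strE natE (fun u => nOf u ^ 2 / 200) :=
    natDiv.comp ((natPow.comp ((natOfUn.comp nOfFP).pair (const _ 2))).pair (const _ 200))
  refine (unOfNatMin.comp (nnFP.pair hb)).congr fun u => ?_
  show min (nOf u ^ 2 / 200) (nOf u * nOf u) = corS (nOf u)
  rw [corS, min_eq_left]
  rw [pow_two]
  exact Nat.div_le_self _ _

/-- **The composition word is written in polynomial time** (brick (W)). [cite: KumarVolk2022, §6 (proof of Cor. 1.3)] [cite: AroraBarak2009, §1.3] -/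
theorem compWord_mem_FP : compWord ∈ FP := by
  obtain ⟨f, hf, hfu⟩ := exists_univWordFn (T := List Bool) (eT := strE) nOfFP corSFP yOfFP
  have : f = compWord := funext fun u => hfu u
  rwa [this] at hf

/-- The padded point as a raw list of sign–magnitude integers, on codes. [cite: AroraBarak2009, §1.3] -/
private theorem ptPadFP : CodeFP strE (rawE smE) (fun u => ptPad (zOf u) (nOf u * nOf u)) := by
  have hl : CodeFP strE (rawE smE) (fun u => decIntList (zOf u)) :=
    ((rawOfList smE).comp (decIntList_codeFP.comp zOfFP)).congr fun _ => rfl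
  have hrep : CodeFP strE (rawE smE) (fun u => List.replicate (nOf u * nOf u) (0 : ℤ)) :=
    (replicateOf smE).comp ((const _ (0 : ℤ)).pair nnFP)
  refine ((rawTakeUn smE).comp (nnFP.pair ((rawAppend smE).comp (hl.pair hrep)))).congr fun u => ?_
  show (decIntList (zOf u) ++ List.replicate (nOf u * nOf u) 0).take (nOf u * nOf u) = ptPad (zOf u) (nOf u * nOf u)
  rw [take_append_replicate]
  rfl

/-- **The point code is written in polynomial time** (`hpt` of the assembly). [cite: KumarVolk2022, Cor. 1.3 (item 2)] [cite: AroraBarak2009, §1.3] -/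
theorem ptList_mem_FP : ptList ∈ FP := by
  obtain ⟨f, hf, hfu⟩ := (listOfRaw smE).comp ptPadFP
  have : f = ptList := funext fun u => (hfu u).trans (by rw [ptList, listE_eq]; rfl)
  rwa [this] at hf

/-- The body of the evaluation circuit through the padded point list. [cite: KabanetsImpagliazzo2003, proof of Cor. 12 (p. 358)] -/
theorem evalBodyN_eq (N : ℕ) (z : List Bool) (B : KBlock) :
    evalBodyN N (ptFun z) B =
      (Gate.sum [] :: ((ptPad z N).map (fun c => Gate.sum [((1 : ℤ), .const c)]) ++ B.map (KGate.toGate (0 + 1))),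
        .gate (N + B.length)) := by
  simp only [evalBodyN, ptPad, List.map_map, Function.comp_def, useOut]

/-- **The evaluation word is written in polynomial time.** [cite: KumarVolk2022, §6 (proof of Cor. 1.3)] [cite: AroraBarak2009, §1.3] -/
theorem evalWord_mem_FP : evalWord ∈ FP := by
  have hitem : CodeFP smE gateE (fun c : ℤ => Gate.sum [((1 : ℤ), Operand.const c)]) :=
    gateSumFP.comp ((rawSingleton _).comp ((const _ (1 : ℤ)).pair opConstFP))
  have hconsts : CodeFP strE (rawE gateE)
      (fun u => (ptPad (zOf u) (nOf u * nOf u)).map fun c => Gate.sum [((1 : ℤ), Operand.const c)]) :=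
    (map₀ hitem).comp ptPadFP
  have hblock : CodeFP strE (rawE gateE) (fun u => ((readBlock (yOf u)).map (KGate.toGate (0 + 1)) : List (Gate ℤ ℕ))) :=
    useBlockFP' (const strE 0) yOfFP
  have hgates : CodeFP strE (listE gateE) (fun u => Gate.sum [] ::
      ((ptPad (zOf u) (nOf u * nOf u)).map (fun c => Gate.sum [((1 : ℤ), Operand.const c)]) ++
        (readBlock (yOf u)).map (KGate.toGate (0 + 1)))) :=
    (listOfRaw gateE).comp ((rawCons gateE).comp ((const _ (Gate.sum ([] : List (ℤ × Operand ℤ ℕ)))).pair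
      ((rawAppend gateE).comp (hconsts.pair hblock))))
  have hout : CodeFP strE opE (fun u => Operand.gate (nOf u * nOf u + (readBlock (yOf u)).length)) :=
    opGateFP.comp (natAdd.comp ((natOfUn.comp nnFP).pair (blockLengthFP yOfFP)))
  have hword : CodeFP strE wordE (fun u => (0, evalBodyN (nOf u * nOf u) (ptFun (zOf u)) (readBlock (yOf u)))) :=
    ((const strE 0).pair (hgates.pair hout)).congr fun u => by rw [evalBodyN_eq]
  obtain ⟨f, hf, hfu⟩ := hword
  have : f = evalWord := funext fun u =>
    (hfu u).trans (by rw [evalWord, circuitWord_eq_wordE, forgetFin_evalCircuit])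
  rwa [this] at hf

end Words

/-! ### §3. The certificate relation and its membership in `P` -/

section Relation

/-- **The certificate relation** `R = {⟨1ⁿ, ⟨y, z⟩⟩ : C_y ∘ Ũ_n ≡ 0 ∧ C_y(a_z) ≠ 0}` of the
`FP^{NP}` construction (DESIGN v3: the non-root point is part of the witness), as a language: the
composition word is a `PITLanguage` instance computing zero and the evaluation word is not.
[cite: KumarVolk2022, §6 (proof of Cor. 1.3: the language L)] -/
def certRel : Language Bool := {u | compWord u ∈ PITLanguage ∧ evalWord u ∉ PITLanguage}

/-- `certRel` as a Boolean combination of two polynomial-time preimages of `PITLanguage`. [cite: AroraBarak2009, §1.3] -/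
theorem certRel_eq : certRel = (compWord ⁻¹' PITLanguage) ⊓ (evalWord ⁻¹' PITLanguage)ᶜ := rfl

/-- **`PIT ∈ P ⇒ R ∈ P`** ("By [the hypothesis], `L ∈ NP`": its verifier's relation is decided by two
identity tests of circuits written in polynomial time). [cite: KumarVolk2022, §6 (proof of Cor. 1.3)] [cite: AroraBarak2009, Thm. 2.8] -/
theorem certRel_mem_P (hPIT : PITLanguage ∈ Classes.P) : certRel ∈ Classes.P := by
  rw [certRel_eq]
  exact inter_mem_P (preimage_mem_P hPIT compWord_mem_FP)
    (compl_mem_P_iff.2 (preimage_mem_P hPIT evalWord_mem_FP))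

end Relation

/-! ### §4. Semantics: the two identity tests, soundness, completeness -/

section Semantics

/-- The universal map on the flat index `q = j·n + i` of the guessed circuit's inputs (the
assembly's `uFin`): `Ũ_n` at `(q / n, q % n)`. [cite: KumarVolk2022, §4.1] -/
theorem finDivMod_eq_symm {n : ℕ} (q : Fin (n * n)) : (finDiv q, finMod q) = finProdFinEquiv.symm q := rfl

/-- `C ∘ Ũ_n` on the flat index is the rename of `blockPolyMat`. [cite: KumarVolk2022, §6 (proof of Cor. 1.3)] -/
theorem bind₁_flat_eq (n s : ℕ) (P : MvPolynomial (Fin (n * n)) ℤ) :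
    bind₁ (fun q : Fin (n * n) => universalMapInt n s (finProdFinEquiv.symm q)) P =
      bind₁ (universalMapInt n s) (rename (fun q : Fin (n * n) => (finDiv q, finMod q)) P) := by
  rw [bind₁_rename]
  rfl

/-- **The two identity tests, semantically**: `⟨1ⁿ, w⟩ ∈ R` iff the guessed gate list `C = readBlock
(fstF w)` satisfies `C ∘ Ũ_n ≡ 0` (as an integer polynomial identity on the flat index) and
`C(a) ≠ 0` at the point `a = ptFun (sndF w)`. [cite: KumarVolk2022, §6 (proof of Cor. 1.3)] -/
theorem mem_certRel_iff (n : ℕ) (w : List Bool) :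
    boolPair (unaryEncodeNat n) w ∈ certRel ↔
      bind₁ (fun q : Fin (n * n) => universalMapInt n (corS n) (finProdFinEquiv.symm q))
          (blockPoly (n * n) (readBlock (fstF w))) = 0 ∧
        eval (fun q : Fin (n * n) => ptFun (sndF w) q) (blockPoly (n * n) (readBlock (fstF w))) ≠ 0 := by
  change (compWord (boolPair (unaryEncodeNat n) w) ∈ PITLanguage ∧
      evalWord (boolPair (unaryEncodeNat n) w) ∉ PITLanguage) ↔ _
  unfold compWord evalWord
  rw [nOf_pair, yOf_pair, zOf_pair, circuitWord_mem_PITLanguage, circuitWord_mem_PITLanguage,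
    eval_univCircuit_eq_zero_iff, eval_evalCircuit_eq_zero_iff, bind₁_flat_eq]
  exact Iff.rfl

/-- **SOUNDNESS** (`hsound` of the assembly): a member `⟨1ⁿ, w⟩` of `R` yields an integer polynomial
`P` with `P ∘ Ũ_n ≡ 0` and an integer point `a` with `P(a) ≠ 0`, and the point code of the input
decodes to `a` (so the assembly's `FP^{NP}` function outputs a matrix outside the image of `Ũ_n`,
`KumarVolk2020.not_mem_smallLinCircuitSet_of_eval_ne_zero`). [cite: KumarVolk2022, §6 (proof of Cor. 1.3: "M does not have linear circuits of size less than n²/200")] -/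
theorem certRel_sound (n : ℕ) (w : List Bool) (h : boolPair (unaryEncodeNat n) w ∈ certRel) :
    ∃ (P : MvPolynomial (Fin (n * n)) ℤ) (a : Fin (n * n) → ℤ),
      bind₁ (fun q : Fin (n * n) => universalMapInt n (corS n) (finProdFinEquiv.symm q)) P = 0 ∧
        eval a P ≠ 0 ∧
        encodingIntBool.listBool.decode (ptList (boolPair (unaryEncodeNat n) w)) = some (List.ofFn a) := by
  obtain ⟨h1, h2⟩ := (mem_certRel_iff n w).1 h
  refine ⟨blockPoly (n * n) (readBlock (fstF w)), fun q => ptFun (sndF w) q, h1, h2, ?_⟩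
  rw [ptList, Encoding.decode_encode, nOf_pair, zOf_pair, ptPad_eq_ofFn]

/-- Length of the code of one sign–magnitude integer in `[0, A]`. [cite: AroraBarak2009, §0.1] -/
private theorem length_smE_le {z : ℤ} {A : ℕ} (h0 : 0 ≤ z) (hA : z ≤ A) : (smE z).length ≤ A + 4 := by
  rw [smE_apply, length_boolPair]
  have h1 : (encodeNat z.natAbs).length ≤ z.natAbs := length_natE_le _
  have h2 : z.natAbs ≤ A := by
    have : (z.natAbs : ℤ) = z := Int.natAbs_of_nonneg h0
    omega
  simp only [List.length_singleton]
  omega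

/-- Length of the honest point code: `≤ N (2A + 10) + 2N + 2`. [cite: AroraBarak2009, §0.1] -/
private theorem length_encode_ofFn_le {N A : ℕ} (a : Fin N → ℤ) (ha : ∀ q, 0 ≤ a q ∧ a q ≤ A) :
    (encodingIntBool.listBool.encode (List.ofFn a)).length ≤ N * (2 * (A + 4) + 2) + (2 * N + 2) := by
  rw [listE_eq, listE, length_boolPair, length_unE, List.length_ofFn, rawE]
  have hb : ∀ x ∈ (List.ofFn a).map encodingIntBool.encode, x.length ≤ A + 4 := by
    intro x hx
    rw [List.mem_map] at hx
    obtain ⟨z, hz, rfl⟩ := hx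
    rw [List.mem_ofFn] at hz
    obtain ⟨q, rfl⟩ := hz
    exact length_smE_le (ha q).1 (ha q).2
  have := length_encList_le hb
  rw [List.length_map, List.length_ofFn] at this
  omega

/-- A cubic absorbed by the assembly's bound shape (exponent kept symbolic). [folklore] -/
private theorem cubic_le_pow (e : ℕ) (he : 14 ≤ e) (X : ℕ) : 140 * (X + 1) ^ 3 ≤ X ^ e + 2000 := by
  rcases Nat.lt_or_ge X 2 with h | h
  · calc 140 * (X + 1) ^ 3 ≤ 140 * 2 ^ 3 := Nat.mul_le_mul_left _ (Nat.pow_le_pow_left (by omega) 3)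
      _ ≤ 2000 := by norm_num
      _ ≤ X ^ e + 2000 := Nat.le_add_left _ _
  · have hX : X + 1 ≤ 2 * X := by omega
    have h1 : 140 * (X + 1) ^ 3 ≤ 1120 * X ^ 3 :=
      calc 140 * (X + 1) ^ 3 ≤ 140 * (2 * X) ^ 3 := Nat.mul_le_mul_left _ (Nat.pow_le_pow_left hX 3)
        _ = 1120 * X ^ 3 := by ring
    have h2 : 1120 ≤ X ^ 11 := le_trans (by norm_num) (Nat.pow_le_pow_left h 11)
    have h3 : 1120 * X ^ 3 ≤ X ^ 11 * X ^ 3 := Nat.mul_le_mul_right _ h2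
    have h4 : X ^ 11 * X ^ 3 ≤ X ^ e := by
      rw [← pow_add]
      exact Nat.pow_le_pow_right (Nat.lt_of_lt_of_le Nat.zero_lt_two h) he
    exact h1.trans (h3.trans (h4.trans (Nat.le_add_right _ _)))

/-- The witness length is cubic in `n + |C| + A`. [folklore] -/
private theorem witness_length_le (n S A : ℕ) {LB LP : ℕ}
    (hLB : LB ≤ (S + 1) * (6 * (n * n + (S + 1)) + 58))
    (hLP : LP ≤ n * n * (2 * (A + 4) + 2) + (2 * (n * n) + 2)) :
    2 * LB + 2 + LP ≤ 140 * (n + S + A + 1) ^ 3 := by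
  set X := n + S + A with hX
  have h1 : n * n ≤ X * X := Nat.mul_le_mul (by omega) (by omega)
  have h2 : LB ≤ (X + 1) * (6 * (X * X) + 6 * (X + 1) + 58) :=
    hLB.trans (Nat.mul_le_mul (by omega) (by omega))
  have h3 : LP ≤ X * X * (2 * (X + 4) + 2) + (2 * (X * X) + 2) :=
    hLP.trans (Nat.add_le_add (Nat.mul_le_mul h1 (by omega)) (by omega))
  have h4 : 2 * ((X + 1) * (6 * (X * X) + 6 * (X + 1) + 58)) + 2 + (X * X * (2 * (X + 4) + 2) + (2 * (X * X) + 2)) ≤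
      140 * (X + 1) ^ 3 := by
    ring_nf
    nlinarith [Nat.zero_le X, Nat.zero_le (X * X), Nat.zero_le (X * X * X)]
  omega

/-- **COMPLETENESS** (`hcomplete` of the assembly): an honest fan-in-two sign-constant integer
circuit `C` over the `n²` inputs with `C ∘ Ũ_n ≡ 0` and a non-root `a ∈ [0, A]^{n²}` give a member
`⟨1ⁿ, ⟨code of C, code of a⟩⟩` of `R` of length polynomial in `n + |C| + A`.
[cite: KumarVolk2022, §6 (proof of Cor. 1.3: "there exists a string y … such that xy describes a … circuit")] -/
theorem certRel_complete : ∃ c₀ : ℕ, ∀ (n : ℕ) (C : ArithCircuit ℤ (Fin (n * n))) (a : Fin (n * n) → ℤ) (A : ℕ),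
    C.IsFanInTwo → C.HasSignConstants →
      bind₁ (fun q : Fin (n * n) => universalMapInt n (corS n) (finProdFinEquiv.symm q)) C.eval = 0 →
        eval a C.eval ≠ 0 → (∀ q, 0 ≤ a q ∧ a q ≤ A) →
          ∃ w : List Bool, w.length ≤ (n + C.size + A) ^ c₀ + c₀ ∧ boolPair (unaryEncodeNat n) w ∈ certRel := by
  refine ⟨2000, fun n C a A h2 hs hU ha hA => ?_⟩
  -- the guessed gate list of `C` (through `ℚ`, x5 g5's descent lemma)
  obtain ⟨B, hBlen, hBidx, hBpoly⟩ := exists_kblock_of_circuit (F := ℚ) (C.map (Int.castRingHom ℚ))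
    (h2.map _) (hs.map _)
  rw [eval_map_apply] at hBpoly
  rw [size_map] at hBlen
  have hBC : blockPoly (n * n) B = C.eval := map_injective _ (Int.castRingHom ℚ).injective_int hBpoly
  refine ⟨boolPair (encBlock B) (encodingIntBool.listBool.encode (List.ofFn a)), ?_, ?_⟩
  · -- length
    have hL1 := length_encBlock_le hBidx
    have hL2 := length_encode_ofFn_le a hA
    rw [hBlen] at hL1
    rw [length_boolPair]
    exact le_trans (witness_length_le n C.size A hL1 hL2) (cubic_le_pow 2000 (by decide) (n + C.size + A))
  · rw [mem_certRel_iff, fstF_boolPair, sndF_boolPair, readBlock_encBlock, hBC]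
    refine ⟨hU, ?_⟩
    have hfun : (fun q : Fin (n * n) => ptFun (encodingIntBool.listBool.encode (List.ofFn a)) q) = a :=
      funext fun q => ptFun_encode a q
    rwa [hfun]

end Semantics

end Cor13Cert

end KumarVolk2020

end Literature.Computability.AlgebraicComplexity
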